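import Mathlib
import Summits.NavierStokesRegularity.NavierStokesRegularity.Theses.RootDecompLitSlice
import Summits.NavierStokesRegularity.NavierStokesRegularity.Theorems.RootDecompLitSliceDarkBallSpreadsAssemblyModuloLocalSpread
import Summits.NavierStokesRegularity.NavierStokesRegularity.Theorems.RootDecompLitSliceDarkBallSpreadsLocalSpread
import Summits.NavierStokesRegularity.NavierStokesRegularity.Theorems.RootDecompLitSliceDarkBallSpreadsVorticityFlatInterface
import HarnessLib

/-!
# Route RootDecompLitSlice — the aside D₁ `DarkBallSpreads` CLOSED
  (stmt-NavierStokesRegularity-29566, the registered stub `stub_darkBallSpreads` of crux D `NoDarkBall`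
  stmt-NavierStokesRegularity-29563)

`Summit.NavierStokesRegularity.NavierStokesRegularity.Theses.RootDecompLitSlice.DarkBallSpreads`:
for `ν, T > 0` and a maximal smooth solution `(u, p)` on `[0, T)` that is Leray–Hopf on `[0, T]` from a
rapidly decaying datum, if `u(T) = 0` a.e. on some ball then `u(T) = 0` a.e. on `ℝ³`.

PROOF = the decomp-ns brick chain (census instrument + route-writer, 2026-08-30/31), assembled by name:
* `darkBallSpreads_of_localSpread` (writer, `…AssemblyModuloLocalSpread`): D₁ from the LOCAL SPREAD
  property of `curl w` on the regular part `Σ_Tᶜ` of the terminal slice, `w` the pointwise limit of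
  `u t` (`t → T⁻`) — via B0 terminal-slice nullity `H¹(Σ_T) = 0` (census), B5/B6′ connectedness of
  `Σ_Tᶜ` (census/writer), B1/B1′ regular-point smoothing and the terminal field (census/writer), B2 slice
  identification `u(T) = w` a.e. (writer), SEED + PROPAGATION (writer), B6″ curl-free & div-free ⟹
  harmonic ⟹ identity theorem across the `H¹`-null closed set (writer);
* `localSpread_of_flatVorticity` (writer, `…LocalSpread`, B4-APPLICATION): the local spread from
  FLATNESS of the vorticity at `(T, x₁)`, by Escauriaza–Seregin–Šverák 2003 Thm 4.1
  (`Literature.Analysis.FluidPDE.ess_unique_continuation_holds`) applied to the reversed vorticity;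
* `flatVorticity_of_terminalLimit` (census, `…VorticityFlatInterface`, B3 + FLAT adapter): flatness
  from `curl w = 0` near `x₁`, by the census's flatness induction on the differentiated vorticity
  equation (`vorticity_flat_of_tendsto_zero`) fed by the writer's derivative tower.

HONEST FRAMING (D-0179): D₁ and D are DECORATIVE for the summit — the residual of crux D is `S` modulo
a theorem; closing them moves NO tribunal verdict and proves nothing about Navier–Stokes regularity
(rung 0). The value is hygiene: the registered stub of D's birth skeleton is now a kernel theorem, so D
no longer carries an open aside. Lands `--workitem stmt-NavierStokesRegularity-29566`
(decomp-ns route-writer g16). [folklore]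
-/

noncomputable section

open Set Filter Topology Metric
open Literature.Analysis.FluidPDE

-- the summit and its single sub-problem share the name (CONVENTIONS §1), as in every Theorems file
set_option linter.dupNamespace false

namespace Summit.NavierStokesRegularity.NavierStokesRegularity.Theorems

/-- The LOCAL SPREAD property of the terminal vorticity, assembled from B4-APPLICATION (writer) and
the FLAT interface (census): for `ν, T > 0`, `(u, p)` classical on `[0, T)`, Leray–Hopf on `[0, T]`
from a rapidly decaying datum, and `w` the pointwise limit of `u t` off `Σ_T`, every regular `x₀` has
a radius `ρ > 0` such that `curl w ≡ 0` near a regular `x₁` within `ρ` of `x₀` forces `curl w ≡ 0`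
near `x₀`. [folklore] -/
theorem localSpread_terminalVorticity :
    ∀ (ν T : ℝ), 0 < ν → 0 < T →
      ∀ (u : ℝ → EuclideanSpace ℝ (Fin 3) → EuclideanSpace ℝ (Fin 3))
        (p : ℝ → EuclideanSpace ℝ (Fin 3) → ℝ),
        IsClassicalNSSolutionOn (Ico 0 T) ν 0 u p → IsLerayHopfOn T ν 0 (u 0) u →
        HasRapidSpatialDecay (u 0) →
        ∀ w : EuclideanSpace ℝ (Fin 3) → EuclideanSpace ℝ (Fin 3),
          (∀ y ∈ {x : EuclideanSpace ℝ (Fin 3) | IsBackwardSingularPoint u (T, x)}ᶜ,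
              Tendsto (fun t => u t y) (𝓝[<] T) (𝓝 (w y))) →
          ∀ x₀ ∈ {x : EuclideanSpace ℝ (Fin 3) | IsBackwardSingularPoint u (T, x)}ᶜ, ∃ ρ > 0,
            ∀ x₁ ∈ {x : EuclideanSpace ℝ (Fin 3) | IsBackwardSingularPoint u (T, x)}ᶜ,
              dist x₁ x₀ < ρ → (∀ᶠ y in 𝓝 x₁, curl w y = 0) → ∀ᶠ y in 𝓝 x₀, curl w y = 0 :=
  fun _ν _T hν hT _u _p hsol hLH hdec _w hw =>
    localSpread_of_flatVorticity hν hT hsol hLH hdec hw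
      (flatVorticity_of_terminalLimit hν hT hsol hLH hdec hw)

/-- **The aside D₁ `DarkBallSpreads` of route RootDecompLitSlice, by name** (stub
`stub_darkBallSpreads` of crux D's birth skeleton): a dark ball at a putative first singular time of a
Leray–Hopf-from-smooth-data maximal solution spreads to a.e. all of `ℝ³`. Decorative for the summit
(D-0179). [folklore] -/
theorem darkBallSpreads :
    Summit.NavierStokesRegularity.NavierStokesRegularity.Theses.RootDecompLitSlice.DarkBallSpreads :=
  darkBallSpreads_of_localSpread localSpread_terminalVorticity

end Summit.NavierStokesRegularity.NavierStokesRegularity.Theorems
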